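import Mathlib.RingTheory.TensorProduct.Basic
import Mathlib.Algebra.Module.Projective
import Mathlib.RingTheory.Finiteness.Basic
import HarnessLib

/-!
# Base change along ring ISOMORPHISMS: `B ⊗_A K ≅ B₀ ⊗_{A₀} K` for `A ≅ A₀`, `B ≅ B₀`

For ring isomorphisms `eA : A ≅ A₀`, `eB : B ≅ B₀` with `B` an `A`-algebra, `B₀` an `A₀`-algebra and
`eB ∘ algebraMap = algebraMap ∘ eA`, and a module `K` carrying COMPATIBLE `A`- and `A₀`-structures
(`a • k = eA a • k`; e.g. the `A`-structure is `Module.compHom K eA`): the additive isomorphism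
`τ : B ⊗_A K ≅ B₀ ⊗_{A₀} K`, `b ⊗ k ↦ eB b ⊗ k`, `eB`-semilinear, compatible with `d ⊗ 1` for a map `d : K → K′`
linear for both structures and with `φ ⊗ 1` along algebra maps; finiteness and projectivity transfer from `A₀`
to `A`; and the induced additive isomorphism of kernels `ker(d ⊗_A B) ≅ ker(d ⊗_{A₀} B₀)`.
Elementary; Mathlib-only. Used by the kernel-representation adapter of the seesaw chart (`Motives/SeesawChart*`):
the chart ring `A = Γ(W, U)` and the test rings `B` are identified with `Γ(Spec A, 𝒪)`, `Γ(Spec B, 𝒪)` by `ΓSpecIso`,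
and the Grothendieck complex lives over the latter ([MumfordAV1970] §5, p. 46: the complex `K•` and its base
changes `K• ⊗_A B`). (Cell `hodgecm-mathlib`, M13 node N1 (1b); author B-p04 (g15).)

## References
* [MumfordAV1970] D. Mumford, *Abelian Varieties* (1970), §5 (p. 46) (base change of the Grothendieck complex).
-/

set_option autoImplicit false

noncomputable section

universe u v

open TensorProduct

namespace Literature.Algebra.Module.RingIsoBaseChange

variable {A A₀ : Type u} [CommRing A] [CommRing A₀] (eA : A ≃+* A₀)
variable {K : Type v} [AddCommGroup K] [Module A K] [Module A₀ K]

/-! ### Transfer of finiteness and projectivity along compatible structures -/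

/-- **Finiteness transfers** from the `A₀`-structure to a compatible `A`-structure (`a • k = eA a • k`).
[cite: MumfordAV1970, §5 (p. 46)] -/
theorem finite_of_compat (hK : ∀ (a : A) (k : K), a • k = eA a • k) [Module.Finite A₀ K] :
    Module.Finite A K := by
  obtain ⟨S, hS⟩ := Module.Finite.fg_top (R := A₀) (M := K)
  refine ⟨⟨S, Submodule.eq_top_iff'.2 fun x => ?_⟩⟩
  have hx : x ∈ Submodule.span A₀ (S : Set K) := by rw [hS]; trivial
  induction hx using Submodule.span_induction with
  | mem y hy => exact Submodule.subset_span hy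
  | zero => exact Submodule.zero_mem _
  | add y z _ _ hy hz => exact Submodule.add_mem _ hy hz
  | smul a₀ y _ hy =>
    have : a₀ • y = (eA.symm a₀) • y := by rw [hK, RingEquiv.apply_symm_apply]
    rw [this]
    exact Submodule.smul_mem _ _ hy

/-- **Projectivity transfers** from the `A₀`-structure to a compatible `A`-structure (Mathlib
`Module.Projective.of_equiv` along the identity, `eA⁻¹`-semilinear). [cite: MumfordAV1970, §5 (p. 46)] -/
theorem projective_of_compat (hK : ∀ (a : A) (k : K), a • k = eA a • k) [Module.Projective A₀ K] :
    Module.Projective A K := by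
  haveI h1 : RingHomInvPair (eA.symm : A₀ →+* A) (eA : A →+* A₀) := RingHomInvPair.of_ringEquiv eA.symm
  haveI h2 : RingHomInvPair (eA : A →+* A₀) (eA.symm : A₀ →+* A) := RingHomInvPair.of_ringEquiv eA
  let e₂ : K ≃ₛₗ[(eA.symm : A₀ →+* A)] K :=
    { Equiv.refl K with
      map_add' := fun _ _ => rfl
      map_smul' := fun a₀ k => by
        change a₀ • k = eA.symm a₀ • k
        rw [hK, RingEquiv.apply_symm_apply] }
  exact Module.Projective.of_equiv e₂

/-! ### A map linear for both structures -/

variable {K' : Type v} [AddCommGroup K'] [Module A K'] [Module A₀ K']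

/-- An `A₀`-linear map between modules with compatible `A`-structures is `A`-linear (non-Prop plumbing: the
same map, re-bundled). [folklore] -/
def restrictAlong (hK : ∀ (a : A) (k : K), a • k = eA a • k) (hK' : ∀ (a : A) (k : K'), a • k = eA a • k)
    (d₀ : K →ₗ[A₀] K') : K →ₗ[A] K' where
  toFun := d₀
  map_add' := map_add d₀
  map_smul' a k := by rw [hK, map_smul, hK', RingHom.id_apply]

/-- `restrictAlong` is the same function. [cite: MumfordAV1970, §5 (p. 46)] -/
@[simp] theorem restrictAlong_apply (hK : ∀ (a : A) (k : K), a • k = eA a • k)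
    (hK' : ∀ (a : A) (k : K'), a • k = eA a • k) (d₀ : K →ₗ[A₀] K') (k : K) :
    restrictAlong eA hK hK' d₀ k = d₀ k := rfl

/-! ### The base-change transport `τ : B ⊗_A K ≅ B₀ ⊗_{A₀} K` -/

section Tau

variable {B B₀ : Type u} [CommRing B] [Algebra A B] [CommRing B₀] [Algebra A₀ B₀] (eB : B ≃+* B₀)
  (heB : ∀ a : A, eB (algebraMap A B a) = algebraMap A₀ B₀ (eA a))

/-- Forward map `b ⊗ k ↦ eB b ⊗ k` (non-Prop plumbing). [folklore] -/
def tauFwd (hK : ∀ (a : A) (k : K), a • k = eA a • k) : B ⊗[A] K →+ B₀ ⊗[A₀] K :=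
  TensorProduct.liftAddHom
    { toFun := fun b => { toFun := fun k => eB b ⊗ₜ[A₀] k
                          map_zero' := by simp
                          map_add' := fun k k' => TensorProduct.tmul_add _ _ _ }
      map_zero' := by ext k; simp
      map_add' := fun b b' => by ext k; simp [TensorProduct.add_tmul] }
    (fun a b k => by
      change eB (a • b) ⊗ₜ[A₀] k = eB b ⊗ₜ[A₀] (a • k)
      rw [Algebra.smul_def, map_mul, heB, ← Algebra.smul_def, hK, TensorProduct.smul_tmul])

/-- Backward map `b₀ ⊗ k ↦ eB⁻¹ b₀ ⊗ k` (non-Prop plumbing). [folklore] -/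
def tauBwd (hK : ∀ (a : A) (k : K), a • k = eA a • k) : B₀ ⊗[A₀] K →+ B ⊗[A] K :=
  TensorProduct.liftAddHom
    { toFun := fun b₀ => { toFun := fun k => eB.symm b₀ ⊗ₜ[A] k
                           map_zero' := by simp
                           map_add' := fun k k' => TensorProduct.tmul_add _ _ _ }
      map_zero' := by ext k; simp
      map_add' := fun b b' => by ext k; simp [TensorProduct.add_tmul] }
    (fun a₀ b₀ k => by
      change eB.symm (a₀ • b₀) ⊗ₜ[A] k = eB.symm b₀ ⊗ₜ[A] (a₀ • k)
      have h1 : eB.symm (a₀ • b₀) = (eA.symm a₀) • eB.symm b₀ := by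
        apply eB.injective
        rw [RingEquiv.apply_symm_apply, Algebra.smul_def, Algebra.smul_def, map_mul, heB,
          RingEquiv.apply_symm_apply, RingEquiv.apply_symm_apply]
      have h2 : a₀ • k = (eA.symm a₀) • k := by rw [hK, RingEquiv.apply_symm_apply]
      rw [h1, h2, TensorProduct.smul_tmul])

/-- **`τ : B ⊗_A K ≅ B₀ ⊗_{A₀} K`**, `b ⊗ k ↦ eB b ⊗ k` (additive isomorphism; non-Prop plumbing).
[cite: MumfordAV1970, §5 (p. 46)] -/
def tau (hK : ∀ (a : A) (k : K), a • k = eA a • k) : B ⊗[A] K ≃+ B₀ ⊗[A₀] K :=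
  { tauFwd eA eB heB hK with
    invFun := tauBwd eA eB heB hK
    left_inv := fun z => by
      change tauBwd eA eB heB hK (tauFwd eA eB heB hK z) = z
      induction z using TensorProduct.induction_on with
      | zero => simp
      | tmul b k => simp [tauFwd, tauBwd]
      | add x y hx hy => rw [map_add, map_add, hx, hy]
    right_inv := fun z => by
      change tauFwd eA eB heB hK (tauBwd eA eB heB hK z) = z
      induction z using TensorProduct.induction_on with
      | zero => simp
      | tmul b k => simp [tauFwd, tauBwd]
      | add x y hx hy => rw [map_add, map_add, hx, hy] }

/-- `τ (b ⊗ k) = eB b ⊗ k`. [cite: MumfordAV1970, §5 (p. 46)] -/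
@[simp] theorem tau_tmul (hK : ∀ (a : A) (k : K), a • k = eA a • k) (b : B) (k : K) :
    tau eA eB heB hK (b ⊗ₜ[A] k) = eB b ⊗ₜ[A₀] k := by
  simp [tau, tauFwd]

/-- `τ⁻¹ (b₀ ⊗ k) = eB⁻¹ b₀ ⊗ k`. [cite: MumfordAV1970, §5 (p. 46)] -/
@[simp] theorem tau_symm_tmul (hK : ∀ (a : A) (k : K), a • k = eA a • k) (b₀ : B₀) (k : K) :
    (tau eA eB heB hK).symm (b₀ ⊗ₜ[A₀] k) = eB.symm b₀ ⊗ₜ[A] k := by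
  apply (tau eA eB heB hK).injective
  rw [AddEquiv.apply_symm_apply, tau_tmul, RingEquiv.apply_symm_apply]

/-- `τ` is `eB`-semilinear. [folklore] [cite: MumfordAV1970, §5 (p. 46)] -/
theorem tau_smul (hK : ∀ (a : A) (k : K), a • k = eA a • k) (b : B) (z : B ⊗[A] K) :
    tau eA eB heB hK (b • z) = eB b • tau eA eB heB hK z := by
  induction z using TensorProduct.induction_on with
  | zero => simp
  | tmul b' k => rw [TensorProduct.smul_tmul', tau_tmul, tau_tmul, TensorProduct.smul_tmul', smul_eq_mul,
      smul_eq_mul, map_mul]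
  | add x y hx hy => rw [smul_add, map_add, map_add, hx, hy, smul_add]

/-- `τ` intertwines `d ⊗_A 1` and `d ⊗_{A₀} 1`. [cite: MumfordAV1970, §5 (p. 46)] -/
theorem tau_baseChange (hK : ∀ (a : A) (k : K), a • k = eA a • k)
    (hK' : ∀ (a : A) (k : K'), a • k = eA a • k) (d₀ : K →ₗ[A₀] K') (z : B ⊗[A] K) :
    tau eA eB heB hK' ((restrictAlong eA hK hK' d₀).baseChange B z) = d₀.baseChange B₀ (tau eA eB heB hK z) := by
  induction z using TensorProduct.induction_on with
  | zero => simp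
  | tmul b k => rw [LinearMap.baseChange_tmul, tau_tmul, tau_tmul, LinearMap.baseChange_tmul, restrictAlong_apply]
  | add x y hx hy => rw [map_add, map_add, hx, hy, map_add, map_add]

/-- **`τ` is natural along algebra maps**: for `φ : B → C` over `A`, `φ₀ : B₀ → C₀` over `A₀` with
`eC ∘ φ = φ₀ ∘ eB`, `τ_C ∘ (φ ⊗ 1) = (φ₀ ⊗ 1) ∘ τ_B`. [cite: MumfordAV1970, §5 (p. 46)] -/
theorem tau_rTensor (hK : ∀ (a : A) (k : K), a • k = eA a • k) {C C₀ : Type u} [CommRing C] [Algebra A C]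
    [CommRing C₀] [Algebra A₀ C₀] (eC : C ≃+* C₀) (heC : ∀ a : A, eC (algebraMap A C a) = algebraMap A₀ C₀ (eA a))
    (φ : B →ₐ[A] C) (φ₀ : B₀ →ₐ[A₀] C₀) (hφ : ∀ b, eC (φ b) = φ₀ (eB b)) (z : B ⊗[A] K) :
    tau eA eC heC hK (φ.toLinearMap.rTensor K z) = φ₀.toLinearMap.rTensor K (tau eA eB heB hK z) := by
  induction z using TensorProduct.induction_on with
  | zero => simp
  | tmul b k =>
    rw [LinearMap.rTensor_tmul, tau_tmul, tau_tmul, LinearMap.rTensor_tmul]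
    change eC (φ b) ⊗ₜ[A₀] k = φ₀ (eB b) ⊗ₜ[A₀] k
    rw [hφ]
  | add x y hx hy => rw [map_add, map_add, hx, hy, map_add, map_add]

/-- Inverse form of `tau_rTensor`: `τ_C⁻¹ ∘ (φ₀ ⊗ 1) = (φ ⊗ 1) ∘ τ_B⁻¹`. [cite: MumfordAV1970, §5 (p. 46)] -/
theorem tau_symm_rTensor (hK : ∀ (a : A) (k : K), a • k = eA a • k) {C C₀ : Type u} [CommRing C] [Algebra A C]
    [CommRing C₀] [Algebra A₀ C₀] (eC : C ≃+* C₀) (heC : ∀ a : A, eC (algebraMap A C a) = algebraMap A₀ C₀ (eA a))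
    (φ : B →ₐ[A] C) (φ₀ : B₀ →ₐ[A₀] C₀) (hφ : ∀ b, eC (φ b) = φ₀ (eB b)) (y : B₀ ⊗[A₀] K) :
    (tau eA eC heC hK).symm (φ₀.toLinearMap.rTensor K y) = φ.toLinearMap.rTensor K ((tau eA eB heB hK).symm y) := by
  apply (tau eA eC heC hK).injective
  rw [AddEquiv.apply_symm_apply, tau_rTensor eA eB heB hK eC heC φ φ₀ hφ, AddEquiv.apply_symm_apply]

/-! ### Kernels -/

/-- **`ker(d ⊗_A B) ≅ ker(d ⊗_{A₀} B₀)`** along `τ` (additive; non-Prop plumbing). [cite: MumfordAV1970, §5 (p. 46)] -/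
def kerTau (hK : ∀ (a : A) (k : K), a • k = eA a • k) (hK' : ∀ (a : A) (k : K'), a • k = eA a • k)
    (d₀ : K →ₗ[A₀] K') :
    LinearMap.ker ((restrictAlong eA hK hK' d₀).baseChange B) ≃+ LinearMap.ker (d₀.baseChange B₀) where
  toFun x := ⟨tau eA eB heB hK x.1, by
    rw [LinearMap.mem_ker, ← tau_baseChange eA eB heB hK hK' d₀, LinearMap.mem_ker.1 x.2, map_zero]⟩
  invFun y := ⟨(tau eA eB heB hK).symm y.1, by
    rw [LinearMap.mem_ker]
    apply (tau eA eB heB hK').injective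
    rw [tau_baseChange eA eB heB hK hK' d₀, AddEquiv.apply_symm_apply, LinearMap.mem_ker.1 y.2, map_zero]⟩
  left_inv x := by apply Subtype.ext; exact (tau eA eB heB hK).symm_apply_apply x.1
  right_inv y := by apply Subtype.ext; exact (tau eA eB heB hK).apply_symm_apply y.1
  map_add' x y := by apply Subtype.ext; exact map_add (tau eA eB heB hK) x.1 y.1

/-- `kerTau` on underlying tensors is `τ`. [cite: MumfordAV1970, §5 (p. 46)] -/
@[simp] theorem coe_kerTau (hK : ∀ (a : A) (k : K), a • k = eA a • k)
    (hK' : ∀ (a : A) (k : K'), a • k = eA a • k) (d₀ : K →ₗ[A₀] K')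
    (x : LinearMap.ker ((restrictAlong eA hK hK' d₀).baseChange B)) :
    ((kerTau eA eB heB hK hK' d₀ x : LinearMap.ker (d₀.baseChange B₀)) : B₀ ⊗[A₀] K) = tau eA eB heB hK x := rfl

/-- `kerTau⁻¹` on underlying tensors is `τ⁻¹`. [cite: MumfordAV1970, §5 (p. 46)] -/
@[simp] theorem coe_kerTau_symm (hK : ∀ (a : A) (k : K), a • k = eA a • k)
    (hK' : ∀ (a : A) (k : K'), a • k = eA a • k) (d₀ : K →ₗ[A₀] K') (y : LinearMap.ker (d₀.baseChange B₀)) :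
    (((kerTau eA eB heB hK hK' d₀).symm y : LinearMap.ker ((restrictAlong eA hK hK' d₀).baseChange B)) :
      B ⊗[A] K) = (tau eA eB heB hK).symm y := rfl

/-- `kerTau` is `eB`-semilinear. [folklore] [cite: MumfordAV1970, §5 (p. 46)] -/
theorem kerTau_smul (hK : ∀ (a : A) (k : K), a • k = eA a • k)
    (hK' : ∀ (a : A) (k : K'), a • k = eA a • k) (d₀ : K →ₗ[A₀] K') (b : B)
    (x : LinearMap.ker ((restrictAlong eA hK hK' d₀).baseChange B)) :
    ((kerTau eA eB heB hK hK' d₀ (b • x) : LinearMap.ker (d₀.baseChange B₀)) : B₀ ⊗[A₀] K) =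
      eB b • ((kerTau eA eB heB hK hK' d₀ x : LinearMap.ker (d₀.baseChange B₀)) : B₀ ⊗[A₀] K) := by
  rw [coe_kerTau, coe_kerTau, Submodule.coe_smul, tau_smul]

/-- `kerTau⁻¹` is `eB⁻¹`-semilinear: `τ⁻¹(eB b • y) = b • τ⁻¹ y`. [folklore] [cite: MumfordAV1970, §5 (p. 46)] -/
theorem kerTau_symm_smul (hK : ∀ (a : A) (k : K), a • k = eA a • k)
    (hK' : ∀ (a : A) (k : K'), a • k = eA a • k) (d₀ : K →ₗ[A₀] K') (b : B)
    (y : LinearMap.ker (d₀.baseChange B₀)) :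
    (kerTau eA eB heB hK hK' d₀).symm (eB b • y) = b • (kerTau eA eB heB hK hK' d₀).symm y := by
  apply (kerTau eA eB heB hK hK' d₀).injective
  apply Subtype.ext
  rw [AddEquiv.apply_symm_apply, kerTau_smul, Submodule.coe_smul, AddEquiv.apply_symm_apply]

end Tau

end Literature.Algebra.Module.RingIsoBaseChange

end
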